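import Summits.QuantumFields.BalabanUV.T4Continuum.Support.NE7AllMinimisersSmallGeneric
import Summits.QuantumFields.BalabanUV.T4Continuum.Support.NE7MinimalOrbitUniqueSU2
import HarnessLib

/-!
# NE7MinimalOrbitUniqueGeneric — PORT MAP P3.3: UNIQUENESS OF THE MINIMAL ORBIT FOR EVERY UNITARY GAUGE GROUP `U(n)` AND EVERY BLOCK SIZE `L ≥ 2`, `d = 4`, NO DISPLAYED HYPOTHESIS
# — `NE7MinimalOrbitUniqueSU2.minimal_orbit_unique_SU2` (gen 105, `card n = 2`, `L = 2`) RE-ISSUED GENERICALLY: over every datum of the small data and at every level, the set of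
# constrained minimisers of `sfClass 4 L N ε` is ONE periodic unitary gauge orbit ([Balaban1985Variational] Thm 1 «at most one critical orbit» TYPE, together with existence (8)∃)

Cell `pub-balaban`, rung (B)+1 sub-cell t4, lineage `b2b-balaban-t4-ne7-p1`, generation 109 (CRUX PROVER NE7 #1 = OWNER of BINDER row NE7).  Memo
`t4/b2b-balaban-t4-ne7-p1-g109/ROAD-G109.md` §3 (PORT MAP item P3.3).  Argument = gen 105's verbatim under the recipe: `U♯` := the (8)∃ minimiser of the SMALLER class `sfClass 4 L N (ε∕4)`
(P2.6 `hint_small_data_generic`), tangent-critical; P3.0a's pair decomposition + the per-level strict line from gen 105's `line_of_small_card` ∕ `kfree_coercivity_card`; gen 99's generic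
«at most one minimal orbit» `vary_eq_self_of_tanCritical_rep_generic` with `hT_energyBlockLandau` and the class package's slice-Poincaré clause forces `X = 0`.
WHAT ([folklore]; 0 def, 0 sorry).  **`minimal_orbit_unique_generic`**: `2 ≤ L → ∃ ε₀ > 0, ∀ 0 < ε ≤ ε₀, ∀ N ≥ 1, ∃ δ_V > 0, ∀ V (unitary, N-periodic, SmallField V δ_V), ∀ k, ∃ U♯,
IsMinimiser 4 (sfClass 4 L N ε) L N k V U♯ ∧ ∀ U′, IsMinimiser … U′ → ∃ u, IsUnitarySite u ∧ IsPeriodicSite u (N·L^k) ∧ gaugeAct u U′ = U♯`.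
HONEST FRAMING (page 1): composition of landed kernel theorems of this lineage (gens 94–109) and [B7]∕[B8]∕[B11] AS TYPED; nothing of Bałaban's asserted as an axiom; finite 4-torus, small data,
constants existential; NOT NE7, NOT NE3; spine count = dagwriter∕referees' call; NOT infinite volume, NOT mass gap, NOT BetaPertH, NOT Clay (continuum YM on T⁴ ⇐ BetaPertH ∧ nine spine
estimates).
-/

set_option autoImplicit false

open scoped BigOperators Matrix Matrix.Norms.L2Operator
open NormedSpace Finset Set

namespace Summit.QuantumFields.BalabanUV.T4Continuum.NE7MinimalOrbitUniqueGeneric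

open Literature.MathematicalPhysics.QuantumFieldTheory.Balaban1983to89
open B7Prop1Explicit B7Prop2Explicit
open T4AveragingDeficitWall (IsUnitaryCfg IsSkewDir SmallField vary curl curlSq dirSq)
open T4AveragingDeficitWallBoundary (IsPeriodicCfg periodBox)
open AveragingDeficitPeriodicCounting (IsPeriodicDir)
open AveragingDeficitMultiLevelPrep (LevelSmall TangentIter)
open MinimalActionLevels (perWin levelAction)
open MinimalActionSandwich (IsMinimiser admissible)
open MinimalActionRate (sfClass)
open NE3HessForm (dAction)
open NE3SlicePoincareShape (SlicePoincare slicePoincare_mono)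
open NE3EnergyShapes (IsUnitarySite IsPeriodicSite gaugeAct_one)
open NE3EnergyWeightedShapes (energyNormW)
open NE7MeanZeroGaugeSliceW (energyBlockLandauW)
open NE7ConvOneStepGenericSlice (hT_energyBlockLandau)
open NE7ConvOneStepGenericSliceTangent (vary_eq_self_of_tanCritical_rep_generic)
open NE7OpenOfMinimisation (tanCritical_of_isMinimiser)
open NE7HintUnconditionalGeneric (hint_small_data_generic)
open NE7PairDecompNL0Generic (decomp_of_nl0_pair_generic)
open NE7EnergyRateWGeneric (line_of_small_card kfree_coercivity_card)
open NE7EnergyClassPoincareGeneric (classPackage)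
open NE7EtaMinimiserGaugeCovariance (levelAction_gaugeAct)
open BlockAverageCurrent (smallField_gaugeAct)
open NE7AllMinimisersSmallGeneric (admissible_mono_radius eq_of_admissible_zero)

noncomputable section

variable {n : Type} [Fintype n] [DecidableEq n]

set_option maxHeartbeats 800000 in
/-- **THE MINIMAL SET IS ONE GAUGE ORBIT, EVERY `U(n)`, EVERY `L ≥ 2`, `d = 4`** (statement and argument in the file header). [folklore] -/
theorem minimal_orbit_unique_generic [Nonempty n] {L : ℕ} (hL : 2 ≤ L) :
    ∃ ε₀ : ℝ, 0 < ε₀ ∧ ∀ ε : ℝ, 0 < ε → ε ≤ ε₀ → ∀ (N : ℕ) [NeZero N], 1 ≤ N →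
      ∃ δV : ℝ, 0 < δV ∧
        ∀ V ∈ {V : Site 4 → Fin 4 → (Matrix n n ℂ)ˣ | IsUnitaryCfg V ∧ IsPeriodicCfg V (N : ℤ) ∧ SmallField V δV},
        ∀ k : ℕ, ∃ Us : Site 4 → Fin 4 → (Matrix n n ℂ)ˣ, IsMinimiser 4 (sfClass 4 L N ε) L N k V Us ∧
          ∀ U' : Site 4 → Fin 4 → (Matrix n n ℂ)ˣ, IsMinimiser 4 (sfClass 4 L N ε) L N k V U' →
            ∃ u : Site 4 → (Matrix n n ℂ)ˣ, IsUnitarySite u ∧ IsPeriodicSite u ((N * L ^ k : ℕ) : ℤ) ∧ gaugeAct u U' = Us := by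
  haveI : NeZero L := ⟨by omega⟩
  have hL1 : 1 ≤ L := by omega
  have hL0 : (0 : ℝ) < L := by exact_mod_cast (show 0 < L by omega)
  obtain ⟨ε₁, hε₁, H⟩ := hint_small_data_generic (n := n) hL
  obtain ⟨ε₂, hε₂, CS, hCS, νc, hνc, κc, hκc, hdec⟩ := decomp_of_nl0_pair_generic (n := n) hL
  obtain ⟨θ₀, CF, CE, hθ₀, -, -, hCE, -, -, hlsP, -, hPE⟩ := classPackage (n := n) (d := 4) (by norm_num) hL
  -- the k-free line with the Poincaré constant `C_E + 1`
  obtain ⟨CP, hCP⟩ : ∃ CP : ℝ, CP = CE + 1 := ⟨_, rfl⟩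
  have hCP1 : 1 ≤ CP := by rw [hCP]; linarith
  have hCP0 : 0 < CP := by linarith
  obtain ⟨Q, hQ⟩ : ∃ Q : ℝ, Q = 2 * (1 + CP) := ⟨_, rfl⟩
  have hQ4 : 4 ≤ Q := by rw [hQ]; linarith
  have hQ0 : 0 < Q := by linarith
  obtain ⟨cL, hcL⟩ : ∃ cL : ℝ, cL = 2 * κc + νc ^ 2 + 2304 * (CS ^ 2 * Real.exp (2 * CS)) + 112 * (1 + 7 * CS ^ 2) + 1 := ⟨_, rfl⟩
  have hcL0 : 0 < cL := by rw [hcL]; positivity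
  have hcard1 : (1 : ℝ) ≤ (Fintype.card n : ℝ) := by exact_mod_cast Fintype.card_pos
  have hcard0 : (0 : ℝ) < (Fintype.card n : ℝ) := by linarith
  obtain ⟨ε₃, hε₃⟩ : ∃ ε₃ : ℝ, ε₃ = (1 / 2) / Q / 4 / (Fintype.card n : ℝ) / cL := ⟨_, rfl⟩
  have hε₃0 : 0 < ε₃ := by rw [hε₃]; positivity
  have hcard : (0 : ℝ) < 1000000000000000000000 * (L : ℝ) ^ 6 * (Fintype.card n : ℝ) := by positivity
  refine ⟨min ε₁ (min ε₂ (min θ₀ (min (1 / (1000000000000000000000 * (L : ℝ) ^ 6 * (Fintype.card n : ℝ))) (min ε₃ 1)))),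
    lt_min hε₁ (lt_min hε₂ (lt_min hθ₀ (lt_min (by positivity) (lt_min hε₃0 one_pos)))), ?_⟩
  intro ε hε hεle N _ hN
  have hεε₁ : ε ≤ ε₁ := hεle.trans (min_le_left _ _)
  have hεε₂ : ε ≤ ε₂ := hεle.trans ((min_le_right _ _).trans (min_le_left _ _))
  have hεθ₀ : ε ≤ θ₀ := hεle.trans ((min_le_right _ _).trans ((min_le_right _ _).trans (min_le_left _ _)))
  have hεθ : ε ≤ 1 / (1000000000000000000000 * (L : ℝ) ^ 6 * (Fintype.card n : ℝ)) :=
    hεle.trans ((min_le_right _ _).trans ((min_le_right _ _).trans ((min_le_right _ _).trans (min_le_left _ _))))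
  have hεε₃ : ε ≤ ε₃ := hεle.trans ((min_le_right _ _).trans ((min_le_right _ _).trans ((min_le_right _ _).trans ((min_le_right _ _).trans (min_le_left _ _)))))
  have hε1 : ε ≤ 1 := hεle.trans ((min_le_right _ _).trans ((min_le_right _ _).trans ((min_le_right _ _).trans ((min_le_right _ _).trans (min_le_right _ _)))))
  have hε4θ : ε / 4 ≤ θ₀ := by linarith
  have hε4 : 0 < ε / 4 := by positivity
  have hθline : 1000000000000000000000 * (L : ℝ) ^ 6 * (Fintype.card n : ℝ) * ε ≤ 1 := by
    rw [le_div_iff₀ hcard] at hεθ; linarith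
  have hsmall : cL * ε ≤ (1 / 2) / Q / 4 / (Fintype.card n : ℝ) := by
    have h1 : cL * ε ≤ cL * ε₃ := mul_le_mul_of_nonneg_left hεε₃ hcL0.le
    have h2 : cL * ε₃ = (1 / 2) / Q / 4 / (Fintype.card n : ℝ) := by rw [hε₃]; field_simp
    linarith only [h1, h2]
  have hline := line_of_small_card (c := (Fintype.card n : ℝ)) hQ4 hcard1 hCS hε hε1 (by rw [← hcL]; exact hsmall)
  have hls : ∀ j : ℕ, LevelSmall 4 L j (ε / ((L : ℝ) ^ (j + 1)) ^ 2) := hlsP hε.le hεθ₀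
  have hls4all : ∀ j : ℕ, LevelSmall 4 L j ((ε / 4) / ((L : ℝ) ^ (j + 1)) ^ 2) := hlsP hε4.le hε4θ
  -- the 𝒯_E instances of (hT) and (hP) from the class package
  have hT : ∀ (j : ℕ) (W : Site 4 → Fin 4 → (Matrix n n ℂ)ˣ), W ∈ sfClass 4 L N ε (j + 1) → ∀ F : Finset (T4AveragingDeficitWall.Plaq 4),
      (∀ φ : Site 4 → Fin 4 → Matrix n n ℂ, IsSkewDir φ → IsPeriodicDir φ ((AveragingDeficitMultiLevelPrep.tower L N (j + 1) : ℕ) : ℤ) →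
        TangentIter L j W φ → dAction W φ F = 0) →
      ∀ Y ∈ energyBlockLandauW (d := 4) (n := n) L N (j + 1) W, dAction W Y F = 0 :=
    fun j W hW F htan => hT_energyBlockLandau hL1 hε.le hls j W hW F htan
  have hP : ∀ (j : ℕ) (W : Site 4 → Fin 4 → (Matrix n n ℂ)ˣ), W ∈ sfClass 4 L N ε (j + 1) →
      SlicePoincare L (j + 1) W (energyBlockLandauW (d := 4) (n := n) L N (j + 1) W) CP (periodBox (d := 4) (N * L ^ (j + 1))) :=
    fun j W hW => slicePoincare_mono (hPE hN hε hεθ₀ j W hW) (by rw [hCP]; linarith)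
  -- the data radii: the (8)∃ minimisers of the `ε`-class and of the `ε/4`-class
  obtain ⟨δ₁, hδ₁, hint₁⟩ := H ε hε hεε₁ N hN
  obtain ⟨δ₄, hδ₄, hint₄⟩ := H (ε / 4) hε4 (by linarith) N hN
  refine ⟨min δ₁ δ₄, lt_min hδ₁ hδ₄, ?_⟩
  intro V hV k
  obtain ⟨hVu, hVP, hVδ⟩ := hV
  have hV₁ : V ∈ {V : Site 4 → Fin 4 → (Matrix n n ℂ)ˣ | IsUnitaryCfg V ∧ IsPeriodicCfg V (N : ℤ) ∧ SmallField V δ₁} :=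
    ⟨hVu, hVP, MinimalActionRate.SmallField.mono hVδ (min_le_left _ _)⟩
  have hV₄ : V ∈ {V : Site 4 → Fin 4 → (Matrix n n ℂ)ˣ | IsUnitaryCfg V ∧ IsPeriodicCfg V (N : ℤ) ∧ SmallField V δ₄} :=
    ⟨hVu, hVP, MinimalActionRate.SmallField.mono hVδ (min_le_right _ _)⟩
  cases k with
  | zero =>
      -- level 0: the datum is the only admissible configuration
      obtain ⟨U₀, hU₀, -⟩ := hint₁ V hV₁ 0
      refine ⟨U₀, hU₀, fun U' hU' => ⟨fun _ => 1, fun _ => (unitaryUnits (Matrix n n ℂ)).one_mem, fun _ _ => rfl, ?_⟩⟩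
      rw [gaugeAct_one, eq_of_admissible_zero hU'.mem, eq_of_admissible_zero hU₀.mem]
  | succ j =>
      obtain ⟨Us, hUs, a, ha0, haε, hUsa⟩ := hint₄ V hV₄ (j + 1)
      have hmem : Us ∈ admissible (sfClass 4 L N ε) L (j + 1) V := admissible_mono_radius (by linarith) hUs.mem
      have hcrit := tanCritical_of_isMinimiser hL1 hN hUs ha0 haε hUsa (hls4all j)
      have hM1 : (1 : ℝ) ≤ (L : ℝ) ^ (j + 1) := one_le_pow₀ (by exact_mod_cast hL1)
      -- every competitor with no larger action is a gauge copy of `U♯`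
      have horbit : ∀ U' ∈ admissible (sfClass 4 L N ε) L (j + 1) V, levelAction 4 L N (j + 1) U' ≤ levelAction 4 L N (j + 1) Us →
          ∃ u : Site 4 → (Matrix n n ℂ)ˣ, IsUnitarySite u ∧ IsPeriodicSite u ((N * L ^ (j + 1) : ℕ) : ℤ) ∧ gaugeAct u U' = Us := by
        intro U' hU' hmin'
        obtain ⟨u, X, XT, XN, α, ν, κ, hu, huP, hXs, hXP, hα, hXα, hgauge, hXdec, hXT, -, hXN, hν, hNw, hN1, hαM, hνle, hκle⟩ :=
          hdec N ε hε hεε₂ hθline V j Us hmem U' hU'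
        -- the per-level strict line from the k-free one
        have hck := kfree_coercivity_card (c := (Fintype.card n : ℝ)) (ε := ε) hcard0 hCP0.le hM1 hν hνle hα hαM
        have hlinek : 2 * κ < ((((1 / 2 - ν ^ 2) / (2 * (1 + CP)) - ν ^ 2) / 2
            - 576 * ((4 : ℕ) : ℝ) * (Real.exp α - 1) ^ 2 * ((L : ℝ) ^ (j + 1)) ^ 2) / (Fintype.card n : ℝ)
            - 28 * ((4 : ℕ) : ℝ) * (ε / ((L : ℝ) ^ (j + 1)) ^ 2 + 7 * α ^ 2) * ((L : ℝ) ^ (j + 1)) ^ 2) := by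
          rw [hQ] at hline
          have h2κ : 2 * κ ≤ 2 * (κc * ε) := by linarith
          push_cast at hck hline ⊢
          linarith
        -- the gauge identity gives the action comparison and the class radius of the representative
        have hle : levelAction 4 L N (j + 1) (vary Us X 1) ≤ levelAction 4 L N (j + 1) U' := by
          rw [← hgauge, levelAction_gaugeAct]
        have h1 : SmallField (vary Us X 1) (ε / ((L : ℝ) ^ (j + 1)) ^ 2) := by
          rw [← hgauge]; exact smallField_gaugeAct hu hU'.1.2.2
        obtain ⟨-, hself⟩ := vary_eq_self_of_tanCritical_rep_generic (d := 4) hL1 hN hε.le hCP0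
          (fun j W => energyBlockLandauW (d := 4) (n := n) L N (j + 1) W) hT hP hmem hcrit hmin' hXs hXP hα hXα hle h1 hXdec hXT hXN hNw hN1 hlinek
        refine ⟨u, hu, huP, ?_⟩
        rw [hgauge, hself]
      -- `U♯` is itself a minimiser of the `ε`-class: the (8)∃ minimiser of the `ε`-class is a gauge copy of it
      obtain ⟨U₁, hU₁, -⟩ := hint₁ V hV₁ (j + 1)
      obtain ⟨u₁, -, -, hg₁⟩ := horbit U₁ hU₁.mem (hU₁.le Us hmem)
      have hUsmin : IsMinimiser 4 (sfClass 4 L N ε) L N (j + 1) V Us := by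
        refine ⟨hmem, fun U' hU' => ?_⟩
        rw [← hg₁, levelAction_gaugeAct]
        exact hU₁.le U' hU'
      exact ⟨Us, hUsmin, fun U' hU' => horbit U' hU'.mem (hU'.le Us hmem)⟩


end

end Summit.QuantumFields.BalabanUV.T4Continuum.NE7MinimalOrbitUniqueGeneric
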